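import Mathlib
import HarnessLib
import HarnessLib.Audit
import Summits.NavierStokesRegularity.Statement
import Literature.Analysis.FluidPDE.TaoAveragedSobolev
import Summits.NavierStokesRegularity.NavierStokesRegularity.Theorems.BlowupAssembly
import Summits.NavierStokesRegularity.NavierStokesRegularity.Theorems.AdiabaticEddyClayUniquenessCore
import HarnessLib.Audit.Status.Attr

/-!
Route: PumpContinuation

DORMANT since 2026-08-26T12:41:30Z (reconciler: no traction for 7.7 d (last activity item-evidence-added at 2026-08-18T19:01:46Z); parked, not closed — `ledger route dormant route-NavierStokesRegularity-PumpContinuation --off` to reacti) — unstaffed, not closed; items shared with open routes are served there. `ledger route dormant <id> --off` reactivates.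

# Route PumpContinuation — drag the proved averaged Type-I pump to the Euler form — no overheating
plus closedness refutes Clay (A)

NEGATIVE side (deciding theorem concludes ¬NavierStokesRegularity); lens barrier-inversion, cycle 2:
the WALL is our own refutation — `Theorems.PerpetualPumpAveragedTypeIBlowup.AveragedTypeIBlowup_of`
(stmt-1835, proved 2026-08-16; `not_Thesis` p123805): a symmetric cancelling averaging datum 𝒜 (m =
2 seeded graded Toda local cascade, Tao Thm 3.2) carries an H¹⁰_df-mild TYPE-I blow-up from a
Schwartz divergence-free datum. Every such witness sits at a FIXED engineered operator, at segment
distance 1 from the Euler form B. The DOOR escapes exactly that clause: along the segment of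
trilinear forms T_θ = (1−θ)·B̃_𝒜 + θ·B (typed over `Tao2016.IsMildSolutionFor`, no new notion),
bounded-temperature Type-I blow-up (Type-I constant ≤ M, fixed) persists for θ arbitrarily close to
1 (crux EulerProximatePump), and bounded-temperature Type-I blow-up is a CLOSED condition in θ (crux
BoundedTemperatureClosed). Then θ = 1 carries a mild Type-I blow-up of the true Navier–Stokes form
from Schwartz data; the support MildBlowupClassical (converse bookkeeping of the proved
EulerTypeIGlue) turns it into X5a, and the in-tree `Literature.NS.blowup_assembly` with the PROVED
X5b (`Theorems.blowup_clay_uniqueness`) refutes Clay (A). X = EulerProximatePump ∧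
BoundedTemperatureClosed ("it suffices to show"); realises card pump-continuation-degree (spine) as
Leray's continuity method in the OPERATOR parameter at Schwartz-data level (no degree theory).
Lean: `(∃ 𝒜 : Literature.Analysis.FluidPDE.Tao2016.AveragingDatum, 𝒜.IsSymmetric ∧ 𝒜.HasCancellation
∧ ∃ M : ℝ, ∀ δ : ℝ, 0 < δ → ∃ θ : ℝ, 1 - δ < θ ∧ θ < 1 ∧ 0 ≤ θ ∧ ∃ u₀ : SchwartzMap (EuclideanSpace
ℝ (Fin 3)) (EuclideanSpace ℝ (Fin 3)), Literature.Analysis.FluidPDE.VectorCalculus.IsDivFree ⇑u₀ ∧ ∃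
S : ℝ, 0 < S ∧ ∃ u : ℝ → Literature.Analysis.FluidPDE.Tao2016.L2C,
Literature.Analysis.FluidPDE.Tao2016.IsMildSolutionFor (fun a b c => ((1 - θ : ℝ) : ℂ) * 𝒜.form a b
c + ((θ : ℝ) : ℂ) * Literature.Analysis.FluidPDE.Tao2016.eulerForm a b c)
(Literature.Analysis.FluidPDE.Tao2016.schwartzL2 u₀) (Set.Ico 0 S) u ∧ (∀ t ∈ Set.Ico 0 S,
MeasureTheory.eLpNorm (u t) ⊤ MeasureTheory.volume ≤ ENNReal.ofReal (M / Real.sqrt (S - t))) ∧ ¬ ∃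
S' : ℝ, S < S' ∧ ∃ v : ℝ → Literature.Analysis.FluidPDE.Tao2016.L2C,
Literature.Analysis.FluidPDE.Tao2016.IsMildSolutionFor (fun a b c => ((1 - θ : ℝ) : ℂ) * 𝒜.form a b
c + ((θ : ℝ) : ℂ) * Literature.Analysis.FluidPDE.Tao2016.eulerForm a b c)
(Literature.Analysis.FluidPDE.Tao2016.schwartzL2 u₀) (Set.Ico 0 S') v ∧ ∀ t ∈ Set.Ico 0 S, v t = u
t) ∧ (∀ 𝒜 : Literature.Analysis.FluidPDE.Tao2016.AveragingDatum, 𝒜.IsSymmetric → 𝒜.HasCancellation →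
∀ M : ℝ, IsClosed {θ : ℝ | θ ∈ Set.Icc (0 : ℝ) 1 ∧ ∃ u₀ : SchwartzMap (EuclideanSpace ℝ (Fin 3))
(EuclideanSpace ℝ (Fin 3)), Literature.Analysis.FluidPDE.VectorCalculus.IsDivFree ⇑u₀ ∧ ∃ S : ℝ, 0 <
S ∧ ∃ u : ℝ → Literature.Analysis.FluidPDE.Tao2016.L2C,
Literature.Analysis.FluidPDE.Tao2016.IsMildSolutionFor (fun a b c => ((1 - θ : ℝ) : ℂ) * 𝒜.form a b
c + ((θ : ℝ) : ℂ) * Literature.Analysis.FluidPDE.Tao2016.eulerForm a b c)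
(Literature.Analysis.FluidPDE.Tao2016.schwartzL2 u₀) (Set.Ico 0 S) u ∧ (∀ t ∈ Set.Ico 0 S,
MeasureTheory.eLpNorm (u t) ⊤ MeasureTheory.volume ≤ ENNReal.ofReal (M / Real.sqrt (S - t))) ∧ ¬ ∃
S' : ℝ, S < S' ∧ ∃ v : ℝ → Literature.Analysis.FluidPDE.Tao2016.L2C,
Literature.Analysis.FluidPDE.Tao2016.IsMildSolutionFor (fun a b c => ((1 - θ : ℝ) : ℂ) * 𝒜.form a b
c + ((θ : ℝ) : ℂ) * Literature.Analysis.FluidPDE.Tao2016.eulerForm a b c)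
(Literature.Analysis.FluidPDE.Tao2016.schwartzL2 u₀) (Set.Ico 0 S') v ∧ ∀ t ∈ Set.Ico 0 S, v t = u
t})`

## Assembly
Pure logic plus two in-tree theorems (GlueTest.lean rc 0, sorry-free): EulerProximatePump gives 𝒜, M
and parameters θ → 1 in the bounded-temperature blow-up set S_M; BoundedTemperatureClosed makes S_M
closed, so 1 ∈ S_M (Metric.mem_closure_iff); at θ = 1 the segment form IS the Euler form (funext;
ring), so NS has a Schwartz-data mild Type-I blow-up; MildBlowupClassical gives X5a with ν = 1;
`Literature.NS.blowup_assembly` with the proved X5b `Theorems.blowup_clay_uniqueness` yields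
¬NavierStokesRegularity.

Rationale: WHY THIS LINE. Limits are opportunities: the averaged Type-I blow-up was built as a barrier
(abstract Type-I exclusion is false, Tao2016AveragedNS arXiv:1402.0290 §1.1 footnote + our
stmt-1835), and this route spends it as the SEED of a homotopy in equation space whose endpoint is
the Millennium counterexample — the trade Jia–Šverák made for FORWARD self-similar solutions
(JiaSverak2014 = arXiv:1204.0529 §5: Leray's method — solvability at small parameter, a-priori
estimate, compactness ⇒ the endpoint), run in the bilinear form instead of the data amplitude and
seeded by a LARGE proved profile instead of small data. Imported: the continuity/continuation method
of nonlinear functional analysis (LeraySchauder1934, Mawhin1999) in its degree-free clopen form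
(openness = blow-up persistence, closedness = no overheating + no loss of compactness), and blow-up
persistence under perturbations of the nonlinearity from semilinear parabolic theory
(arXiv:1506.08306; Galaktionov's p-branching of blow-up profiles, arXiv:0903.0981) as the model for
the openness lemma. What no listed route does: every negative route fixes the equation and hunts a
profile (DSS/RSS/Hou/Landau/merger templates) or dials viscosity (ReynoldsMonotone), the Type-I
constant (EulerMelnikovDss) or the dimension (DimensionLadder); none moves the OPERATOR across Tao's
class from a point where Type-I blow-up is a theorem. The death of PerpetualPump (refuted:Thesis,
the seed's negation) is used, not re-wanted.

RANKED CRUXES. #2 EulerProximatePump (crux) — THE DOOR (Euler-proximate pumps at bounded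
temperature): there are a symmetric cancelling averaging datum 𝒜 and a ceiling M such that for every
δ > 0 some θ ∈ (1−δ, 1) ∩ [0,1) makes the segment form T_θ = (1−θ)B̃_𝒜 + θB admit an H¹⁰_df-mild
solution from a Schwartz divergence-free datum on [0,S) with the Type-I rate ‖u(t)‖_∞ ≤
M(S−t)^(−1/2) and NO mild extension past S (card K1+K2+K3 at data level: seed + persistence + no
overheating below the Euler end; birth skeleton EulerProximatePump_of = clopen on [0,θ₁], θ₁ < 1).
[difficulty: XL] (why it might fail: The wall may extend to Euler-proximity: the pump OVERHEATS (inf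
Type-I constant →∞ as θ→1; forced if NS excludes Type I and closedness holds; Chae–Wolf pressure at
fine DSS ratio) or folds; cheapest falsifier = homotope the m=2 Toda circuit toward Euler couplings
(kit ODE), watch temperature.) [Tao2016AveragedNS, JiaSverak2014, arXiv:1506.08306, arXiv:0903.0981,
ChaeWolf2017, Mawhin1999]
#3 BoundedTemperatureClosed (crux) — THE LINK (no loss of compactness at bounded temperature): for
every symmetric cancelling averaging datum 𝒜 and every ceiling M, the set of θ ∈ [0,1] at which T_θ
admits a Schwartz-data H¹⁰_df-mild Type-I blow-up with constant ≤ M and no mild extension is CLOSED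
— limits of bounded-temperature blow-up parameters are blow-up parameters (scaling normalisation of
the blow-up time, compactness of Type-I windows, persistence of the singularity, truncation of the
limiting ignition data back to a Schwartz field; birth skeleton BoundedTemperatureClosed_of =
stub_compactData + stub_limitWitness via sequential closedness). [difficulty: L] (why it might fail:
Bounded temperature does not bound the ignition DATA: along θₙ→θ witnesses may escape to an
infinite-energy ancient profile whose truncation to Schwartz data (DssFarFieldSlaving's far-field
problem, backwards) fails — then even NS's infimal Type-I constant need not be attained.)
[AlbrittonBarker2019, arXiv:1510.07504, Tao2016AveragedNS, KochNadirashviliSereginSverak2009,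
Tao2011]
#9 MildBlowupClassical (support) — Mild-to-classical bookkeeping at the Euler end (converse
direction of PerpetualPump's PROVED EulerTypeIGlue, stmt-1838): an H¹⁰_df-mild solution of the true
Navier–Stokes form (Tao (1.5), ν = 1) from a Schwartz divergence-free datum with no mild extension
past S yields X5a — a maximal smooth Leray–Hopf solution with finite lifespan from a rapidly
decaying datum (classical solution from the datum is H¹⁰-mild; H¹⁰-mild uniqueness; a classical life
beyond S would be a mild extension). [difficulty: provable-now] [Tao2016AveragedNS, Tao2011,
KochNadirashviliSereginSverak2009]

TWO-LAYER PLAN. EulerProximatePump ⇐ SeedOpen (0 ∈ S_M — provable now from AveragedTypeIBlowup_of,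
bc/special.lean — and S_M relatively open in every [0,θ₁], θ₁ < 1) → ClosedBelow (S_M ∩ [0,θ₁]
closed, θ₁ < 1) → EulerProximatePump (glue = connectedness of [0,θ₁], proved in the birth skeleton).
BoundedTemperatureClosed ⇐ CompactData (normalised witnesses with H¹⁰-convergent data along a
subsequence) → LimitWitness (continuous dependence + persistence of non-extension) →
BoundedTemperatureClosed (glue = IsSeqClosed.isClosed, proved in the birth skeleton). Nothing filed
now.

KILL CRITERIA. A theorem 'bounded-temperature Type-I exclusion is OPEN at the Euler end' (for every
𝒜, M there is δ with no Type-I blow-up of constant ≤ M for θ ∈ (1−δ,1]) refutes EulerProximatePump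
outright ⇒ close refuted:EulerProximatePump and file the overheating law as a barrier entry
(quantitative robustness of Type-I exclusion). Numerical overheating on the Toda-to-Euler circuit
homotopy (temperature ~ (1−θ)^(−a)) ⇒ pivot the seed (another pump of Tao's class; card K1 wants a
NONDEGENERATE pump — the integrable Toda orbit may be degenerate) or retire with the measured law. A
loss-of-compactness example in Tao's class at bounded temperature refutes BoundedTemperatureClosed ⇒
restate closedness for NORMALISED-data witnesses (stub_limitWitness form) and move truncation into
the door. NoTypeIBlowup (stmt-1217) proved for NS ⇒ Door ∧ Closed is false: the route dies but names
which half (overheating vs compactness) — informative either way. X5a proved elsewhere moots the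
route.

NOT DECOMPOSED YET. The nondegeneracy (Floquet spectrum off 1 modulo symmetries) of the seed's DSS
orbit; the uniform-in-θ H¹⁰ local theory with continuous dependence for the segment forms (abstract,
provable, layer-2 child of both cruxes); the scaling covariance of the segment forms used to
normalise blow-up times; the far-field truncation lemma; whether the path must leave the affine
segment (period-doubling of the DSS factor to beat Chae–Wolf's λ₁(C₀)). All are layer-2 children
once a crux is claimed.

CHEAPEST FALSIFIER. Kit ODE, one batched job: take the m = 2 seeded graded Toda circuit of
CircuitPump (λ = 2 and λ = 1.5 replications exist: kit j010589, A* = 71.130 / 122.879), form the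
Galerkin projection of the Euler symbol on the same cascade wavelet modes, homotope the circuit
coefficients linearly (weight θ) and continue the k = 1 DSS threshold orbit in θ, recording its
critical sup-amplitude ('temperature'): monotone divergence before θ = 1 = overheating observed for
this seed; also compute the Floquet multipliers of the Toda orbit at θ = 0 (a multiplier 1 beyond
the symmetry directions = degenerate seed, persistence doubtful). Not run by this seat (planner;
compute goes to the refuter/kit lane). Literature side (run): no theorem of the form 'Type-I
exclusion for all forms of Tao's class near B' exists (it would exceed Tsai's conjecture; searches
below).

NUMBERS. Seed: Type-I constant of the Toda cascade witness M₀ = c·M (stub_supBound × chain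
functional bound, PerpetualPumpAveragedTypeIBlowup.lean); circuit thresholds A* = 71.130 (λ = 2),
122.879 (λ = 1.5), 40.770 (Tao-type) from Cruxes/CircuitPump/TRIAGE-r1-3.md; Chae–Wolf: no λ-DSS
Type-I NS blow-up for 1 < λ < λ₁(C₀) (non-quantitative, chaeWolf2017_removing_dss_holds); Leray
lower bound forces C ≥ c√ν for any NS Type-I constant (counterexample_typeI_constant_ge; normal form
C/√ν ≥ 1.035, Cruxes/Target triage). Items at open: 4 (2 cruxes, 1 support, 1 assembly).

DEFINITION REQUESTS. None: AveragingDatum, AveragingDatum.form/IsSymmetric/HasCancellation,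
IsMildSolutionFor, eulerForm, schwartzL2, L2C (Literature.Analysis.FluidPDE.TaoAveragedSobolev),
IsMaximalSmoothSolution, IsLerayHopfOn, HasRapidSpatialDecay exist; the segment form is written
inline.

Novelty: Searches (2026-08-17): `lit search --hybrid "homotopy in the nonlinearity blow-up persists averaged
Navier-Stokes Euler bilinear operator"` (8 book hits, none on operator homotopy: Lemarié-Rieusset
2016 ch. 22 cheap/averaged models, Robinson–Rodrigo–Sadowski 2016); `lit galaxy search "averaged
Navier-Stokes" --star all` (30 rows, all RANS/engineering, 0 relevant); `lit galaxy search
"continuation of blow-up solutions along a family of equations homotopy" --star all` (0); `lit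
search --source s2 "blow-up stability homotopy bilinear operator Navier-Stokes averaged equation
Type I"` (5, nearest Galaktionov–Mitidieri–Pohozaev 2014 monograph doi:10.1201/b17415, branching of
blow-up patterns); `lit search --source arxiv "Galaktionov self-similar blow-up branching"` (2:
arXiv:0903.0981, arXiv:1009.5864 — p-branching of self-similar blow-up profiles in the EXPONENT of a
scalar parabolic equation); `lit read arxiv:1204.0529 --grep degree|Leray-Schauder|homotop` (pp. 2,
11: Leray's method in the data amplitude, forward SS); OpenAlex/zbMATH/S2 budgets exhausted this
session (429s logged); all 60 open route headers + 19 open cards of the sub read; `lean search` /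
in-tree: no decl mentions a convex combination of `AveragingDatum.form` with `eulerForm`.
Nearest prior art found: JiaSverak2014 (arXiv:1204.0529 §5: Leray–Schauder continuation in the
amplitude μ ∈ [0,1] for FORWARD self-similar NS profiles, degree 1 at small μ); arXiv:0903.0981
(Galaktionov: branching of blow-up similarity pro  [refs: 10.1201/b17415, 0903.0981, 1009.5864, 1204.0529, doi:10.1201/b17415, arxiv:1204.0529, JiaSverak2014]

Barriers (technique_class: operator-homotopy, continuity-method, blowup-persistence): - technique_class: operator-homotopy, continuity-method, blowup-persistence
- Literature.Barriers.NavierStokesRegularity.TaoAveragedBlowup: used as a RESOURCE (its Type-I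
strengthening, our AveragedTypeIBlowup_of, is the seed at θ = 0); nothing is argued abstractly on
the positive side, so the barrier and the route are consistent by construction.
- Literature.Barriers.NavierStokesRegularity.LeraySelfSimilarBlowupExclusion: escaping hypothesis =
exact self-similarity: a branch of exactly self-similar finite-local-energy profiles provably cannot
arrive (NRŠ/Tsai, LeraySelfSimilarBlowupExclusion_holds) — it must overheat or fold before θ = 1;
the seed is DISCRETELY self-similar (k ≥ 1 staircase), where only Tsai's open conjecture stands.
- Literature.Barriers.NavierStokesRegularity.AxisymmetricTypeIExclusion: escaping hypothesis =
axisymmetry: an axisymmetric branch would be killed at θ = 1 by KNSS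
(knss_no_axisymmetric_typeI_holds); the cascade-wavelet seed and its segment are not axisymmetric.
- Literature.Barriers.NavierStokesRegularity.CriticalNormBlowupNecessity: respected, not evaded:
every Type-I blow-up on the segment has divergent L³ (rate M(S−t)^(−1/2) saturating), as ESS/Seregin
require at θ = 1.
- Literature.Barriers.NavierStokesRegularity.DyadicCascadeRegularity: escaping hypothesis = the
unforced scalar KP pump at ratio 2: the seed is Tao's m = 2 graded Toda CIRCUIT at fine ratio
(CircuitPump), outside BMR's invariant region theorem.
- Literature.Barriers.NavierSto

History (route lifecycle, newest last):
- 2026-08-26T12:41:30Z · DORMANT — reconciler: no traction for 7.7 d (last activity item-evidence-added at 2026-08-18T19:01:46Z); parked, not closed — `ledger route dormant route-NavierStokesRegu (operator:999:2624839)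

sub-problem: NavierStokesRegularity · status: dormant · opened planner-plan-lens3-NavierStokesRegularity-barrier-g2-0 2026-08-17T02:26:30Z · rev 2 · ledger route-NavierStokesRegularity-PumpContinuation
GENERATED by the gate from the ledger (D-0016/17). Provers cite these decls: `theorem foo : Summit.NavierStokesRegularity.NavierStokesRegularity.Theses.PumpContinuation.<Decl> := …` in Summits/NavierStokesRegularity/NavierStokesRegularity/Theorems/<Name>.lean.
-/

namespace Summit.NavierStokesRegularity.NavierStokesRegularity.Theses.PumpContinuation

open scoped BigOperators Topology Manifold Classical MeasureTheory ProbabilityTheory Matrix InnerProductSpace ComplexConjugate ContinuousMap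
open Filter Set Function TopologicalSpace MeasureTheory

attribute [summit_statement] _root_.NavierStokesRegularity

open Literature.NS

/-- item stmt-NavierStokesRegularity-18302 · crux · rank 2 · open · by planner
why it might fail: The wall may extend to Euler-proximity: the pump OVERHEATS (inf Type-I constant →∞ as θ→1; forced if NS excludes Type I and closedness holds; Chae–Wolf pressure at fine DSS ratio) or folds; cheapest falsifier = homotope the m=2 Toda circuit toward Euler couplings (kit ODE), watch temperature.
sources: Tao2016AveragedNS, JiaSverak2014, arXiv:1506.08306, arXiv:0903.0981, ChaeWolf2017, Mawhin1999
[crux] THE DOOR (Euler-proximate pumps at bounded temperature): there are a symmetric cancelling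
averaging datum 𝒜 and a ceiling M such that for every δ > 0 some θ ∈ (1−δ, 1) ∩ [0,1) makes the
segment form T_θ = (1−θ)B̃_𝒜 + θB admit an H¹⁰_df-mild solution from a Schwartz divergence-free
datum on [0,S) with the Type-I rate ‖u(t)‖_∞ ≤ M(S−t)^(−1/2) and NO mild extension past S (card
K1+K2+K3 at data level: seed + persistence + no overheating below the Euler end; birth skeleton
EulerProximatePump_of = clopen on [0,θ₁], θ₁ < 1). [difficulty: XL] -/
@[route_item "route-NavierStokesRegularity-PumpContinuation", crux]
def EulerProximatePump : Prop :=
  ∃ 𝒜 : Literature.Analysis.FluidPDE.Tao2016.AveragingDatum, 𝒜.IsSymmetric ∧ 𝒜.HasCancellation ∧ ∃ M : ℝ, ∀ δ : ℝ, 0 < δ → ∃ θ : ℝ, 1 - δ < θ ∧ θ < 1 ∧ 0 ≤ θ ∧ ∃ u₀ : SchwartzMap (EuclideanSpace ℝ (Fin 3)) (EuclideanSpace ℝ (Fin 3)), Literature.Analysis.FluidPDE.VectorCalculus.IsDivFree ⇑u₀ ∧ ∃ S : ℝ, 0 < S ∧ ∃ u : ℝ → Literature.Analysis.FluidPDE.Tao2016.L2C,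 Literature.Analysis.FluidPDE.Tao2016.IsMildSolutionFor (fun a b c => ((1 - θ : ℝ) : ℂ) * 𝒜.form a b c + ((θ : ℝ) : ℂ) * Literature.Analysis.FluidPDE.Tao2016.eulerForm a b c) (Literature.Analysis.FluidPDE.Tao2016.schwartzL2 u₀) (Set.Ico 0 S) u ∧ (∀ t ∈ Set.Ico 0 S, MeasureTheory.eLpNorm (u t) ⊤ MeasureTheory.volume ≤ ENNReal.ofReal (M / Real.sqrt (S - t))) ∧ ¬ ∃ S' : ℝ, S < S' ∧ ∃ v : ℝ → Literature.Analysis.FluidPDE.Tao2016.L2C, Literature.Analysis.FluidPDE.Tao2016.IsMildSolutionFor (fun a b c => ((1 - θ : ℝ) : ℂ) * 𝒜.form a b c + ((θ : ℝ) : ℂ) * Literature.Analysis.FluidPDE.Tao2016.eulerForm a b c) (Literature.Analysis.FluidPDE.Tao2016.schwartzL2 u₀) (Set.Ico 0 S') v ∧ ∀ t ∈ Set.Ico 0 S, v t = u t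

/-- item stmt-NavierStokesRegularity-18303 · crux · rank 3 · open · by planner
why it might fail: Bounded temperature does not bound the ignition DATA: along θₙ→θ witnesses may escape to an infinite-energy ancient profile whose truncation to Schwartz data (DssFarFieldSlaving's far-field problem, backwards) fails — then even NS's infimal Type-I constant need not be attained.
sources: AlbrittonBarker2019, arXiv:1510.07504, Tao2016AveragedNS, KochNadirashviliSereginSverak2009, Tao2011
[crux] THE LINK (no loss of compactness at bounded temperature): for every symmetric cancelling
averaging datum 𝒜 and every ceiling M, the set of θ ∈ [0,1] at which T_θ admits a Schwartz-data
H¹⁰_df-mild Type-I blow-up with constant ≤ M and no mild extension is CLOSED — limits of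
bounded-temperature blow-up parameters are blow-up parameters (scaling normalisation of the blow-up
time, compactness of Type-I windows, persistence of the singularity, truncation of the limiting
ignition data back to a Schwartz field; birth skeleton BoundedTemperatureClosed_of =
stub_compactData + stub_limitWitness via sequential closedness). [difficulty: L] -/
@[route_item "route-NavierStokesRegularity-PumpContinuation", crux]
def BoundedTemperatureClosed : Prop :=
  ∀ 𝒜 : Literature.Analysis.FluidPDE.Tao2016.AveragingDatum, 𝒜.IsSymmetric → 𝒜.HasCancellation → ∀ M : ℝ, IsClosed {θ : ℝ | θ ∈ Set.Icc (0 : ℝ) 1 ∧ ∃ u₀ : SchwartzMap (EuclideanSpace ℝ (Fin 3)) (EuclideanSpace ℝ (Fin 3)), Literature.Analysis.FluidPDE.VectorCalculus.IsDivFree ⇑u₀ ∧ ∃ S : ℝ, 0 < S ∧ ∃ u : ℝ → Literature.Analysis.FluidPDE.Tao2016.L2C, Literature.Analysis.FluidPDE.Tao2016.IsMildSolutionFor (fun a b c => ((1 - θ : ℝ) : ℂ) * 𝒜.form a b c + ((θ : ℝ) : ℂ) * Literature.Analysis.FluidPDE.Tao2016.eulerForm a b c) (Literature.Analysis.FluidPDE.Tao2016.schwartzL2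 u₀) (Set.Ico 0 S) u ∧ (∀ t ∈ Set.Ico 0 S, MeasureTheory.eLpNorm (u t) ⊤ MeasureTheory.volume ≤ ENNReal.ofReal (M / Real.sqrt (S - t))) ∧ ¬ ∃ S' : ℝ, S < S' ∧ ∃ v : ℝ → Literature.Analysis.FluidPDE.Tao2016.L2C, Literature.Analysis.FluidPDE.Tao2016.IsMildSolutionFor (fun a b c => ((1 - θ : ℝ) : ℂ) * 𝒜.form a b c + ((θ : ℝ) : ℂ) * Literature.Analysis.FluidPDE.Tao2016.eulerForm a b c) (Literature.Analysis.FluidPDE.Tao2016.schwartzL2 u₀) (Set.Ico 0 S') v ∧ ∀ t ∈ Set.Ico 0 S, v t = u t}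

/-- item stmt-NavierStokesRegularity-18304 · support · rank 9 · closed · proved by Summit.NavierStokesRegularity.NavierStokesRegularity.Theorems.pumpContinuation_mildBlowupClassical_proof @ fb3a6cdbe8b2 (prover) · by planner
sources: Tao2016AveragedNS, Tao2011, KochNadirashviliSereginSverak2009
[support] Mild-to-classical bookkeeping at the Euler end (converse direction of PerpetualPump's
PROVED EulerTypeIGlue, stmt-1838): an H¹⁰_df-mild solution of the true Navier–Stokes form (Tao
(1.5), ν = 1) from a Schwartz divergence-free datum with no mild extension past S yields X5a — a
maximal smooth Leray–Hopf solution with finite lifespan from a rapidly decaying datum (classical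
solution from the datum is H¹⁰-mild; H¹⁰-mild uniqueness; a classical life beyond S would be a mild
extension). [difficulty: provable-now] -/
@[route_item "route-NavierStokesRegularity-PumpContinuation", crux]
def MildBlowupClassical : Prop :=
  ∀ u₀ : SchwartzMap (EuclideanSpace ℝ (Fin 3)) (EuclideanSpace ℝ (Fin 3)), Literature.Analysis.FluidPDE.VectorCalculus.IsDivFree ⇑u₀ → ∀ S : ℝ, 0 < S → ∀ u : ℝ → Literature.Analysis.FluidPDE.Tao2016.L2C, Literature.Analysis.FluidPDE.Tao2016.IsMildSolutionFor Literature.Analysis.FluidPDE.Tao2016.eulerForm (Literature.Analysis.FluidPDE.Tao2016.schwartzL2 u₀) (Set.Ico 0 S) u → (¬ ∃ S' : ℝ, S < S' ∧ ∃ v : ℝ → Literature.Analysis.FluidPDE.Tao2016.L2C, Literature.Analysis.FluidPDE.Tao2016.IsMildSolutionFor Literature.Analysis.FluidPDE.Tao2016.eulerForm (Literature.Analysis.FluidPDE.Tao2016.schwartzL2 u₀) (Set.Ico 0 S') v ∧ ∀ t ∈ Set.Ico 0 S, v t = u t) → ∃ T : ℝ, 0 < T ∧ ∃ (w : ℝ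 → EuclideanSpace ℝ (Fin 3) → EuclideanSpace ℝ (Fin 3)) (p : ℝ → EuclideanSpace ℝ (Fin 3) → ℝ), Literature.Analysis.FluidPDE.IsMaximalSmoothSolution 1 0 w p T ∧ Literature.Analysis.FluidPDE.IsLerayHopfOn T 1 0 (w 0) w ∧ Literature.Analysis.FluidPDE.HasRapidSpatialDecay (w 0)

-- `MildBlowupClassical` holds: proved by `Summit.NavierStokesRegularity.NavierStokesRegularity.Theorems.pumpContinuation_mildBlowupClassical_proof` @ fb3a6cdbe8b2 (its module imports this route file, so no `_holds` link can be stated here).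

/-- item stmt-NavierStokesRegularity-18305 · assembly · rank 1 · closed · proved by Summit.NavierStokesRegularity.NavierStokesRegularity.Theorems.pumpContinuation_assembly_proof @ 09223c2957f5 (prover) · by planner
sources: Tao2016AveragedNS, Tao2011
[assembly] EulerProximatePump → BoundedTemperatureClosed → MildBlowupClassical →
¬NavierStokesRegularity (recorded shape; the deciding theorem `closes` in glue.lean carries the
actual proof). -/
@[route_item "route-NavierStokesRegularity-PumpContinuation"]
def Assembly : Prop :=
  EulerProximatePump → BoundedTemperatureClosed → MildBlowupClassical → ¬ NavierStokesRegularity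

-- `Assembly` holds: proved by `Summit.NavierStokesRegularity.NavierStokesRegularity.Theorems.pumpContinuation_assembly_proof` @ 09223c2957f5 (its module imports this route file, so no `_holds` link can be stated here).

/-! D-0027 §2.1 — DECIDING THEOREM (planner-authored via `route open/edit --closes-file`; by planner-plan-lens3-NavierStokesRegularity-barrier-g2-0 2026-08-17T02:26:30Z):
its hypotheses are this route's items and its conclusion the sub-problem Statement (glue_lint), and it elaborates with this file. -/

@[closes "route-NavierStokesRegularity-PumpContinuation"] theorem closes (hDoor : EulerProximatePump) (hClosed : BoundedTemperatureClosed)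
    (hBridge : MildBlowupClassical) : ¬ _root_.NavierStokesRegularity := by
  classical
  obtain ⟨𝒜, hsym, hcanc, M, hM⟩ := hDoor
  have hcl := hClosed 𝒜 hsym hcanc M
  -- the bounded-temperature blow-up set along the segment (Icc-guarded), as in `BoundedTemperatureClosed`
  set Sset : Set ℝ := {θ : ℝ | θ ∈ Set.Icc (0 : ℝ) 1 ∧ ∃ u₀ : SchwartzMap (EuclideanSpace ℝ (Fin 3)) (EuclideanSpace ℝ (Fin 3)), Literature.Analysis.FluidPDE.VectorCalculus.IsDivFree ⇑u₀ ∧ ∃ S : ℝ, 0 < S ∧ ∃ u : ℝ → Literature.Analysis.FluidPDE.Tao2016.L2C, Literature.Analysis.FluidPDE.Tao2016.IsMildSolutionFor (fun a b c => ((1 - θ : ℝ) : ℂ) * 𝒜.form a b c + ((θ : ℝ) : ℂ) * Literature.Analysis.FluidPDE.Tao2016.eulerForm a b c) (Literature.Analysis.FluidPDE.Tao2016.schwartzL2 u₀) (Set.Ico 0 S) u ∧ (∀ t ∈ Set.Ico 0 S, MeasureTheory.eLpNorm (u t) ⊤ MeasureTheory.volume ≤ ENNReal.ofReal (M / Real.sqrt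 (S - t))) ∧ ¬ ∃ S' : ℝ, S < S' ∧ ∃ v : ℝ → Literature.Analysis.FluidPDE.Tao2016.L2C, Literature.Analysis.FluidPDE.Tao2016.IsMildSolutionFor (fun a b c => ((1 - θ : ℝ) : ℂ) * 𝒜.form a b c + ((θ : ℝ) : ℂ) * Literature.Analysis.FluidPDE.Tao2016.eulerForm a b c) (Literature.Analysis.FluidPDE.Tao2016.schwartzL2 u₀) (Set.Ico 0 S') v ∧ ∀ t ∈ Set.Ico 0 S, v t = u t} with hSset
  -- 1 is in the closure of Sset, by the Door
  have h1cl : (1 : ℝ) ∈ closure Sset := by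
    rw [Metric.mem_closure_iff]
    intro ε hε
    obtain ⟨θ, hθ1, hθ2, hθ0, hrest⟩ := hM ε hε
    refine ⟨θ, ⟨⟨hθ0, hθ2.le⟩, hrest⟩, ?_⟩
    rw [Real.dist_eq, abs_of_nonneg (by linarith)]
    linarith
  have h1 : (1 : ℝ) ∈ Sset := by
    rw [hcl.closure_eq] at h1cl
    exact h1cl
  obtain ⟨-, u₀, hdiv, S, hS, u, hmild, -, hnoext⟩ := h1
  -- at θ = 1 the segment form is the Euler form
  have hform : (fun a b c => (((1 : ℝ) - 1 : ℝ) : ℂ) * 𝒜.form a b c + (((1 : ℝ) : ℝ) : ℂ) * Literature.Analysis.FluidPDE.Tao2016.eulerForm a b c) = Literature.Analysis.FluidPDE.Tao2016.eulerForm := by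
    funext a b c
    push_cast
    ring
  rw [hform] at hmild hnoext
  obtain ⟨T, hT, w, p, hmax, hLH, hdec⟩ := hBridge u₀ hdiv S hS u hmild hnoext
  exact Literature.NS.blowup_assembly ⟨⟨1, one_pos, T, hT, w, p, hmax, hLH, hdec⟩, Summit.NavierStokesRegularity.NavierStokesRegularity.Theorems.blowup_clay_uniqueness⟩

end Summit.NavierStokesRegularity.NavierStokesRegularity.Theses.PumpContinuation
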